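import Summits.QuantumFields.BalabanUV.Beta.D1BFx.GluonLocalProjWord
import Summits.QuantumFields.BalabanUV.Beta.D1BFx.NeedleProjProjRow
import Summits.QuantumFields.BalabanUV.Beta.D1BFx.GluonNeedleGlue
import Summits.QuantumFields.BalabanUV.Beta.D1BFx.GluonLegProfile

/-!
# `BalabanUV.Beta.D1BFx.GluonLocalProjRow` — road «BF-x» for binder row D1, slot (K), END row `hGrp gN`, «GN-P»: THE `SbT ⊗ proj` PIECE OF THE GLUON
# NEEDLE ROW T₁ IS n-UNIFORM — `|cellSum n a SbT (projPiece n a) μ ν| ≤ C_P` for every `n ≥ 1`, ONE `C_P ≥ 0` — hypothesis `hp` of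
# `GluonNeedleGlueT12.h₁_of_pieces` VERBATIM, modulo [B5, Prop. 1.2] ∧ [B5, (1.126)–(1.127)] BY NAME (2∕15 cells of the gluon needle rows)

HONEST DEPENDENCY (cell records, verbatim): «continuum YM on T⁴ ⇐ BetaPertH ∧ nine spine estimates (0/9 proved); BetaPertH ⇐ (D1) ∧ (D4) ∧
CAP+tail; G-an2-4 gates asym, D1 and NE2/3/4.»  HONEST FRAMING (cell contract, verbatim): «discharging `BetaPertH` makes Bałaban's UV stability
UNCONDITIONAL — a real constructive-QFT result; it is NOT the continuum limit and NOT the Clay problem.»  THIS MODULE DISCHARGES NOTHING of the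
wall: [folklore] counting, modulo the two NAMED printed statements `B5.Prop12Printed (fam nOf hn1 MOf a ha)` ([B5, Prop. 1.2]) and
`B5.Kernel126_127Printed (kfam nOf MOf)` ([B5, (1.126)–(1.127)]) which enter ONLY through the letters (`GluonLegProfile.exists_abs_Ga_le_profile`,
`GluonLegProfileD1.exists_abs_Ga_diff(_left)_le_profile`, `NeedleProjLetters.exists_applyK_colGrad_le`∕`_applyKT_rowGrad_le`,
`NeedleProjLettersD1.exists_applyK_colGrad_diff_le`∕`_applyKT_rowGrad_diff_le`, `GluonLegTails.spr_Ga_of_prop12`) — hypotheses, never proved here —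
composed with the owner's frame `LocalVertexForm.exists_SbT_outer_bound` (absolute `K`, `R`), `RankOneBubble(Jets)` (`dJetSw_eq_outer_sub`,
`applyK(T)_bondInd`, `bubble_outer_sub_right`, `locV_*`), `SectorRecut.exists_biLoc_SbT`, `RJetProjector.decays_Pgt`, `ProjectorSupNorm.abs_Pgt_diff_le_sup`,
leaf-04-g9's `LatticeHLSRadial.sum_exp_div_nrm_pow_le`, `NeedleProjProjRow` (`abs_weight_le_sq`, `sum_exp_scale_le`, `sum_resSite_avg_le`),
`WindowIdentification.fullSum_eq_tsum_sub`.  No `def`, no `def … : Prop`, nothing cited beyond those two named statements, 0 sorry.  Root-level binders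
hW ∕ hR-sockets ∕ hSX-socket ∕ D1Tel ∕ D1Rep — 0 discharged; (K) NOT closed; NOT D1, NOT `BetaPertH`, NOT continuum, NOT Clay.

ABSOLUTE RULE (cell charter, verbatim): «No internally-minted statement may enter as a cited fact. Every hypothesis is either kernel-proved in
this package or a verbatim quotation of a PUBLISHED theorem with page reference. The manuscript(s) under audit are NOT citable for their own
disputed steps — they are the thing under adjudication; programme-internal (2001/route/tribunal) claims are never citable.»

WHY (owner records `HOME/b2b-balaban-beta-d1-p2/GLUON-NEEDLE-ROWS.md` v0.2 «GN-CELLS», row «T₁∕T₂ P-piece `SbT ⊗ proj`»; an3-g57 `N36-SPLIT.v1.md` §3′ (4)).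
THE COUNT.  The word at `(b, w)` is `−½·bubble Ga (SbT μ (b+w)) (dJetSw ν b P)`, `dJetSw ν b P = c′ ⊗ δ − δ ⊗ r′` (`c′ = ∇_col P(·, b+e_ν)`,
`r′ = ∇_row P(b+e_ν, ·)`, `δ = δ_{(b,ν)}`).  By the frame each of the two terms is `≤ K·(Φ₁Γ₀ + Φ₀Γ₁ + Φ₁Γ₁)` with the window bounds of its two
ENDS around the vertex `u = b + w` (radius `R`): term 1 has row end `Ga(b, ·)` (`Φ₀ = A₀·c₂·e^{−(δ∕n)‖w‖}∕nrm(w)²`, `Φ₁ = A₁·c₃·e∕nrm(w)³` — entry and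
second-variable d1 profiles of the leg, the window shift costing `c_p = e^{δR}(R+1)^p`) and column end `Ga c′` (`Γ₀ = kC∕n³`, `Γ₁ = kC′∕n⁴`); term 2 has
row end `r′Ga` (`kC∕n³`, `kC′∕n⁴`) and column end `Ga(·, b)` (entry and first-variable d1 profiles) — the same three products.  The (1.22) sum:
`|w_μw_ν| ≤ nrm(w)²`, so `Σ_w nrm²·[A₁c₃e∕nrm³·(kC+kC′)n⁻³ + A₀c₂e∕nrm²·kC′n⁻⁴] ≤ A₁c₃(kC+kC′)·n⁻³·Σ_w e∕nrm + A₀c₂kC′·n⁻⁴·Σ_w e ≍ n⁻³·n³ + n⁻⁴·n⁴ = n⁰`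
(`sum_exp_div_nrm_pow_le` at `p = 1`, `sum_exp_scale_le`); the base average is convex (`sum_resSite_avg_le`).  an3 predicted `n⁻¹` for this piece;
`n⁰` is what `hp` needs and what these letters give.
* (part 1 `GluonLocalProjWord`: window shifts and the pointwise word bound `abs_locProj_word_le`.)
* §3 [folklore] `sum_exp_div_nrm_le_cube`, **`abs_fullSum_le_of_envelope`** (the (1.22) sum at one base site from a two-envelope pointwise bound `P·e∕nrm³ + Q·e∕nrm²` — generic, reused by every `SbT` piece of T₁ ∕ T₂).
* §4 [folklore] **`exists_locProj_row_le`** (`∃ C ≥ 0, ∀ n [NeZero n], |cellSum n a SbT (projPiece n a) μ ν| ≤ C`, modulo `h12`∕`h126`).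
NOT HERE (honest): the T₂ mirror `proj ⊗ SbT` (needs the transposed placement of the frame); the K- and Q̇-pieces.
Unit `b2b-balaban-beta-d1-p2` (gen 10), road «BF-x» OWNER; `LEAVES-BFx.md` row (N) «GN-P».
-/

namespace Summit.QuantumFields.BalabanUV.Beta.D1BFx.GluonLocalProjRow

open Finset Real
open scoped BigOperators
open Literature.MathematicalPhysics.QuantumFieldTheory.Balaban1983to89
open Literature.MathematicalPhysics.QuantumFieldTheory.Balaban1983to89.Beta
open B12Sec2to5 (l1 l1_nonneg)
open B4Sect5Proof (latticeConst latticeConst_nonneg)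
open B6QGQLower276 (X e blk B mem_B)
open ExpKernelCalculus (Site MKer Decays bubble summable_exp_shift summable_exp_shift' l1_sub_symm)
open DyadicShell (Pt toReal toReal_apply)
open BubbleTransfer (unitVec)
open WindowIdentification (fullSum fullSum_eq_tsum_sub)
open DressedMomentNormalisation (resSite)
open VectorTailsLoc (fam kfam)
open PoissonInterior (nrm nrm_pos one_le_nrm nrm_neg supNorm supNorm_neg supNorm_add_le)
open Summit.QuantumFields.BalabanUV.Beta.TameKernelCalculus (Spr Loc)
open Summit.QuantumFields.BalabanUV.Beta.D1BFx.PackedKernelSplit (biBubble bubble_eq_biBubble)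
open Summit.QuantumFields.BalabanUV.Beta.D1BFx.FineHessianSectors (biBubbleTable biBubbleTable_apply)
open Summit.QuantumFields.BalabanUV.Beta.D1BFx.RProjector (Pgt Pgt_symm deltaPP deltaPP_pos)
open Summit.QuantumFields.BalabanUV.Beta.D1BFx.RJetProjector (decays_Pgt)
open Summit.QuantumFields.BalabanUV.Beta.D1BFx.ProjectorSupNorm (cPPs cPPs_nonneg abs_Pgt_diff_le_sup)
open Summit.QuantumFields.BalabanUV.Beta.D1BFx.GluonLeg (Ga Ga_apply Ga_symm)
open Summit.QuantumFields.BalabanUV.Beta.D1BFx.GluonLegTails (spr_Ga_of_prop12)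
open Summit.QuantumFields.BalabanUV.Beta.D1BFx.GluonLegProfile (exists_abs_Ga_le_profile)
open Summit.QuantumFields.BalabanUV.Beta.D1BFx.GluonLegProfileD1 (exists_abs_Ga_diff_le_profile exists_abs_Ga_diff_left_le_profile)
open Summit.QuantumFields.BalabanUV.Beta.D1BFx.GhostLeg (cast_pred_add_one)
open Summit.QuantumFields.BalabanUV.Beta.D1BFx.FrozenLegTails (nOf MOf hn1)
open Summit.QuantumFields.BalabanUV.Beta.D1BFx.SectorRecut (SbT exists_biLoc_SbT)
open Summit.QuantumFields.BalabanUV.Beta.D1BFx.GluonNeedleSplit (projPiece projPiece_apply)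
open Summit.QuantumFields.BalabanUV.Beta.D1BFx.GluonNeedleGlue (cellSum cellSum_def)
open Summit.QuantumFields.BalabanUV.Beta.D1BFx.RankOneBubble (outer applyK applyKT pairing applyK_apply applyKT_apply bubble_outer_sub_right LocV)
open Summit.QuantumFields.BalabanUV.Beta.D1BFx.RankOneBubbleJets (bondInd bondInd_apply colGrad rowGrad dJetSw_eq_outer_sub applyK_bondInd applyKT_bondInd
  locV_bondInd locV_colGrad locV_rowGrad)
open Summit.QuantumFields.BalabanUV.Beta.D1BFx.NeedleProjLetters (exists_applyK_colGrad_le exists_applyKT_rowGrad_le unitVec_eq_e')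
open Summit.QuantumFields.BalabanUV.Beta.D1BFx.NeedleProjLettersD1 (exists_applyK_colGrad_diff_le exists_applyKT_rowGrad_diff_le)
open Summit.QuantumFields.BalabanUV.Beta.D1BFx.NeedleProjProjRow (abs_weight_le_sq sum_exp_scale_le sum_resSite_avg_le)
open Summit.QuantumFields.BalabanUV.Beta.D1BFx.LatticeHLSProfiles (supNorm_dyadic)
open Summit.QuantumFields.BalabanUV.Beta.D1BFx.LatticeHLSRadial (nrm_eq_max sum_exp_div_nrm_pow_le)
open Summit.QuantumFields.BalabanUV.Beta.D1BFx.LocalVertexForm (exists_SbT_outer_bound)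

open Summit.QuantumFields.BalabanUV.Beta.D1BFx.GluonLocalProjWord (abs_locProj_word_le)

noncomputable section

/-! ## §3 The (1.22) sum at one base site, from a two-envelope pointwise bound -/

section Row

variable (n : ℕ) [NeZero n]

/-- [folklore] the scale-`n` damped inverse-first-power sum over any finite set: `Σ_{w∈S} e^{−(δ∕n)‖w‖}∕nrm(w) ≤ (1 + 432·(2∕δ)²·(1 + 2∕δ))·n³`
(leaf-04-g9's `sum_exp_div_nrm_pow_le` at `p = 1`, the `n`-powers collected). -/
theorem sum_exp_div_nrm_le_cube {δ : ℝ} (hδ : 0 < δ) (S : Finset Pt) :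
    ∑ w ∈ S, Real.exp (-(δ / n) * supNorm (d := 4) w) / nrm (d := 4) w ≤ (1 + 432 * ((2 / δ) ^ 2 * (1 + 2 / δ))) * (n : ℝ) ^ 3 := by
  have hn : (0 : ℝ) < n := by exact_mod_cast Nat.pos_of_ne_zero (NeZero.ne n)
  have hn1 : (1 : ℝ) ≤ n := by exact_mod_cast NeZero.one_le
  have h := sum_exp_div_nrm_pow_le (d := 4) (by norm_num) (ε := δ / n) (by positivity) (p := 1) (by norm_num) S 0
  simp only [sub_zero, pow_one] at h
  refine h.trans ?_
  have e2 : (1 : ℝ) + 2 * (4 : ℕ) * 3 ^ (4 - 1) * (((4 - 1 - 1 : ℕ).factorial : ℝ) * (2 / (δ / n)) ^ (4 - 1 - 1) * (1 + 2 / (δ / n)))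
      = 1 + 432 * ((2 / δ) ^ 2 * (n : ℝ) ^ 2 * (1 + 2 / δ * n)) := by
    rw [show (4 : ℕ) - 1 - 1 = 2 by norm_num, Nat.factorial_two]
    push_cast
    field_simp
    ring
  rw [e2]
  have h3 : (2 / δ) ^ 2 * (n : ℝ) ^ 2 * (1 + 2 / δ * n) ≤ (2 / δ) ^ 2 * (1 + 2 / δ) * (n : ℝ) ^ 3 := by
    have h4 : (1 : ℝ) + 2 / δ * n ≤ (1 + 2 / δ) * n := by
      have : 0 ≤ 2 / δ := by positivity
      nlinarith
    calc (2 / δ) ^ 2 * (n : ℝ) ^ 2 * (1 + 2 / δ * n) ≤ (2 / δ) ^ 2 * (n : ℝ) ^ 2 * ((1 + 2 / δ) * n) :=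
          mul_le_mul_of_nonneg_left h4 (by positivity)
      _ = _ := by ring
  have h5 : (1 : ℝ) ≤ (n : ℝ) ^ 3 := one_le_pow₀ hn1
  nlinarith [h3, h5, sq_nonneg (2 / δ)]

/-- [folklore] **THE (1.22) SUM FROM A TWO-ENVELOPE POINTWISE BOUND** (the shape every `SbT` piece of T₁ ∕ T₂ produces): if
`|T w| ≤ P·e^{−(δ∕n)‖w‖}∕nrm(w)³ + Q·e^{−(δ∕n)‖w‖}∕nrm(w)²` for all `w`, then `|fullSum (w ↦ w_μw_ν·T w)| ≤ P·C₁(δ)·n³ + Q·C₀(δ)·n⁴`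
(`|w_μw_ν| ≤ nrm(w)²`; `Σ_w e∕nrm ≤ C₁n³` by `sum_exp_div_nrm_le_cube`, `Σ_w e ≤ C₀n⁴` by `sum_exp_scale_le`; domination, `summable_of_sum_le`,
`fullSum_eq_tsum_sub`). -/
theorem abs_fullSum_le_of_envelope {T : Pt → ℝ} {δ P Q : ℝ} (hδ : 0 < δ) (hP : 0 ≤ P) (hQ : 0 ≤ Q)
    (hT : ∀ w : Pt, |T w| ≤ P * (Real.exp (-(δ / n) * supNorm (d := 4) w) / nrm (d := 4) w ^ 3)
      + Q * (Real.exp (-(δ / n) * supNorm (d := 4) w) / nrm (d := 4) w ^ 2)) (μ ν : Fin 4) :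
    |fullSum (fun w : Pt => toReal w μ * toReal w ν * T w)|
      ≤ P * ((1 + 432 * ((2 / δ) ^ 2 * (1 + 2 / δ))) * (n : ℝ) ^ 3) + Q * ((1 + 1296 * ((2 / δ) ^ 3 * (1 + 2 / δ))) * (n : ℝ) ^ 4) := by
  set C₁ : ℝ := 1 + 432 * ((2 / δ) ^ 2 * (1 + 2 / δ)) with hC₁
  set C₀ : ℝ := 1 + 1296 * ((2 / δ) ^ 3 * (1 + 2 / δ)) with hC₀
  set Kw : Pt → ℝ := fun w => toReal w μ * toReal w ν * T w with hKw
  set g : Pt → ℝ := fun w => P * (Real.exp (-(δ / n) * supNorm (d := 4) w) / nrm (d := 4) w) + Q * Real.exp (-(δ / n) * supNorm (d := 4) w)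
    with hg
  have hg0 : ∀ w, 0 ≤ g w := fun w => by
    have := nrm_pos (d := 4) w
    rw [hg]; dsimp only; positivity
  -- pointwise domination: `nrm² × (P·e∕nrm³ + Q·e∕nrm²) = P·e∕nrm + Q·e`
  have hdom : ∀ w : Pt, |Kw w| ≤ g w := by
    intro w
    have hnrm := nrm_pos (d := 4) w
    have hwt : |toReal w μ * toReal w ν| ≤ nrm (d := 4) w ^ 2 := by
      refine (abs_weight_le_sq w μ ν).trans ?_
      rw [supNorm_dyadic]
      exact pow_le_pow_left₀ (by positivity) (by rw [nrm_eq_max]; exact le_max_right _ _) 2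
    rw [hKw]; dsimp only
    rw [abs_mul]
    refine (mul_le_mul hwt (hT w) (abs_nonneg _) (by positivity)).trans (le_of_eq ?_)
    rw [hg]; dsimp only
    field_simp
  -- the dominating sum is finite and bounded
  have hfin : ∀ S : Finset Pt, ∑ w ∈ S, g w ≤ P * (C₁ * (n : ℝ) ^ 3) + Q * (C₀ * (n : ℝ) ^ 4) := by
    intro S
    have hs1 := sum_exp_div_nrm_le_cube n hδ S
    have hs0 : ∑ w ∈ S, Real.exp (-(δ / n) * supNorm (d := 4) w) ≤ C₀ * (n : ℝ) ^ 4 :=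
      (le_of_eq (Finset.sum_congr rfl fun w _ => by rw [supNorm_dyadic])).trans ((sum_exp_scale_le n hδ S).trans (le_of_eq (by rw [hC₀])))
    simp only [hg]
    rw [Finset.sum_add_distrib, ← Finset.mul_sum, ← Finset.mul_sum]
    exact add_le_add (mul_le_mul_of_nonneg_left hs1 hP) (mul_le_mul_of_nonneg_left hs0 hQ)
  have hs : Summable g := summable_of_sum_le hg0 hfin
  have ht : ∑' w, g w ≤ P * (C₁ * (n : ℝ) ^ 3) + Q * (C₀ * (n : ℝ) ^ 4) := hs.tsum_le_of_sum_le hfin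
  have hsK : Summable Kw := Summable.of_norm_bounded hs fun w => by rw [Real.norm_eq_abs]; exact hdom w
  rw [fullSum_eq_tsum_sub _ hsK]
  have h0 : Kw 0 = 0 := by simp [hKw, toReal_apply]
  rw [h0, sub_zero]
  have h1 : ‖∑' w : Pt, Kw w‖ ≤ ∑' w : Pt, g w := tsum_of_norm_bounded hs.hasSum fun w => by rw [Real.norm_eq_abs]; exact hdom w
  rw [Real.norm_eq_abs] at h1
  exact h1.trans ht

end Row

/-! ## §4 The cell: frame and letters instantiated, n-powers cancelled -/

/-- [folklore] **«GN-P»: THE `SbT ⊗ proj` PIECE OF T₁ IS n-UNIFORM**, modulo [B5, Prop. 1.2] ∧ [B5, (1.126)–(1.127)] BY NAME: one `C ≥ 0` with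
`|cellSum n a SbT (projPiece n a) μ ν| ≤ C` for every `n ≥ 1` — hypothesis `hp` of `GluonNeedleGlueT12.h₁_of_pieces` (there for `n ≥ 2`, a fortiori). -/
theorem exists_locProj_row_le (a : ℝ) (ha : 0 < a) (h12 : B5.Prop12Printed (fam nOf hn1 MOf a ha)) (h126 : B5.Kernel126_127Printed (kfam nOf MOf))
    (μ ν : Fin 4) : ∃ C : ℝ, 0 ≤ C ∧ ∀ (n : ℕ) [NeZero n], |cellSum n a SbT (projPiece n a) μ ν| ≤ C := by
  obtain ⟨K, R, hK, hframe⟩ := exists_SbT_outer_bound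
  obtain ⟨A₀, δa, hδa, hA₀, hprof⟩ := exists_abs_Ga_le_profile a ha h12 h126
  obtain ⟨A₁, δb, hδb, hA₁, hdR⟩ := exists_abs_Ga_diff_le_profile a ha h12 h126
  obtain ⟨A₂, δc, hδc, hA₂, hdL⟩ := exists_abs_Ga_diff_left_le_profile a ha h12 h126
  obtain ⟨kC, δ₁, _, hkC, hKC⟩ := exists_applyK_colGrad_le a ha h12 h126
  obtain ⟨kT, δ₂, _, hkT, hKT⟩ := exists_applyKT_rowGrad_le a ha h12 h126
  obtain ⟨kC', δ₃, _, hkC', hKC'⟩ := exists_applyK_colGrad_diff_le a ha h12 h126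
  obtain ⟨kT', δ₄, _, hkT', hKT'⟩ := exists_applyKT_rowGrad_diff_le a ha h12 h126
  -- common constants: rate δm := min of the three profile rates, A₁m := max A₁ A₂, kM := max kC kT, kM' := max kC' kT'
  set δm : ℝ := min δa (min δb δc) with hδm
  have hδm0 : 0 < δm := lt_min hδa (lt_min hδb hδc)
  have hδma : δm ≤ δa := min_le_left _ _
  have hδmb : δm ≤ δb := (min_le_right _ _).trans (min_le_left _ _)
  have hδmc : δm ≤ δc := (min_le_right _ _).trans (min_le_right _ _)
  set A₁m : ℝ := max A₁ A₂ with hA₁m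
  have hA₁m0 : 0 ≤ A₁m := hA₁.trans (le_max_left _ _)
  set kM : ℝ := max kC kT with hkM
  have hkM0 : 0 ≤ kM := hkC.trans (le_max_left _ _)
  set kM' : ℝ := max kC' kT' with hkM'
  have hkM'0 : 0 ≤ kM' := hkC'.trans (le_max_left _ _)
  set C : ℝ := K * (A₁m * (Real.exp (δm * R) * ((R : ℝ) + 1) ^ 3) * (kM + kM') * (1 + 432 * ((2 / δm) ^ 2 * (1 + 2 / δm)))
      + A₀ * (Real.exp (δm * R) * ((R : ℝ) + 1) ^ 2) * kM' * (1 + 1296 * ((2 / δm) ^ 3 * (1 + 2 / δm)))) with hC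
  refine ⟨C, by positivity, fun n _ => ?_⟩
  have hn : (0 : ℝ) < n := by exact_mod_cast Nat.pos_of_ne_zero (NeZero.ne n)
  have hA : Spr (Ga n a) := spr_Ga_of_prop12 (a := a) (ha := ha) h12 h126 n
  -- the letters at this n, weakened to the common constants
  have hexpm : ∀ {δ' : ℝ}, δm ≤ δ' → ∀ t : ℝ, 0 ≤ t → Real.exp (-(δ' / n) * t) ≤ Real.exp (-(δm / n) * t) := by
    intro δ' hle t ht
    rw [Real.exp_le_exp]
    have : δm / n * t ≤ δ' / n * t := mul_le_mul_of_nonneg_right (div_le_div_of_nonneg_right hle hn.le) ht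
    linarith
  have hprofn : ∀ (x y : Pt) (κ l : Fin 4), |Ga n a x y κ l| ≤ A₀ * Real.exp (-(δm / n) * supNorm (d := 4) (y - x)) / nrm (d := 4) (y - x) ^ 2 :=
    fun x y κ l => (hprof n x y κ l).trans (div_le_div_of_nonneg_right
      (mul_le_mul_of_nonneg_left (hexpm hδma _ (by positivity)) hA₀) (by have := nrm_pos (d := 4) (y - x); positivity))
  have hdRn : ∀ (x y : Pt) (κ l ρ : Fin 4), |Ga n a x (y + unitVec ρ) κ l - Ga n a x y κ l|
      ≤ A₁m * Real.exp (-(δm / n) * supNorm (d := 4) (y - x)) / nrm (d := 4) (y - x) ^ 3 :=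
    fun x y κ l ρ => (hdR n x y κ l ρ).trans (div_le_div_of_nonneg_right
      (mul_le_mul (le_max_left _ _) (hexpm hδmb _ (by positivity)) (Real.exp_pos _).le hA₁m0) (by have := nrm_pos (d := 4) (y - x); positivity))
  have hdLn : ∀ (x y : Pt) (κ l ρ : Fin 4), |Ga n a (x + unitVec ρ) y κ l - Ga n a x y κ l|
      ≤ A₁m * Real.exp (-(δm / n) * supNorm (d := 4) (x - y)) / nrm (d := 4) (x - y) ^ 3 :=
    fun x y κ l ρ => (hdL n x y κ l ρ).trans (div_le_div_of_nonneg_right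
      (mul_le_mul (le_max_right _ _) (hexpm hδmc _ (by positivity)) (Real.exp_pos _).le hA₁m0) (by have := nrm_pos (d := 4) (x - y); positivity))
  have hexp1 : ∀ {δ' : ℝ} (_ : 0 < δ') (t : ℝ), 0 ≤ t → Real.exp (-(δ' * t)) ≤ 1 := fun hδ' t ht => by
    rw [Real.exp_le_one_iff]; nlinarith
  have hC0n : ∀ (q x : Pt) (α : Fin 4), |applyK (Ga n a) (colGrad (Pgt n a) q) x α| ≤ kM / (n : ℝ) ^ 3 := fun q x α =>
    (hKC n q x α).trans ((mul_le_of_le_one_right (by positivity) (hexp1 (by assumption) _ dist_nonneg)).trans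
      (div_le_div_of_nonneg_right (le_max_left _ _) (by positivity)))
  have hT0n : ∀ (p z : Pt) (β : Fin 4), |applyKT (rowGrad (Pgt n a) p) (Ga n a) z β| ≤ kM / (n : ℝ) ^ 3 := fun p z β =>
    (hKT n p z β).trans ((mul_le_of_le_one_right (by positivity) (hexp1 (by assumption) _ dist_nonneg)).trans
      (div_le_div_of_nonneg_right (le_max_right _ _) (by positivity)))
  have hC1n : ∀ (q x : Pt) (α i : Fin 4), |applyK (Ga n a) (colGrad (Pgt n a) q) (x + unitVec i) α - applyK (Ga n a) (colGrad (Pgt n a) q) x α|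
      ≤ kM' / (n : ℝ) ^ 4 := fun q x α i =>
    (hKC' n q x α i).trans ((mul_le_of_le_one_right (by positivity) (hexp1 (by assumption) _ dist_nonneg)).trans
      (div_le_div_of_nonneg_right (le_max_left _ _) (by positivity)))
  have hT1n : ∀ (p z : Pt) (β i : Fin 4), |applyKT (rowGrad (Pgt n a) p) (Ga n a) (z + unitVec i) β - applyKT (rowGrad (Pgt n a) p) (Ga n a) z β|
      ≤ kM' / (n : ℝ) ^ 4 := fun p z β i =>
    (hKT' n p z β i).trans ((mul_le_of_le_one_right (by positivity) (hexp1 (by assumption) _ dist_nonneg)).trans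
      (div_le_div_of_nonneg_right (le_max_right _ _) (by positivity)))
  -- one base site: pointwise two-envelope bound, then the (1.22) sum, then the n-powers
  set c₂ : ℝ := Real.exp (δm * R) * ((R : ℝ) + 1) ^ 2 with hc₂
  set c₃ : ℝ := Real.exp (δm * R) * ((R : ℝ) + 1) ^ 3 with hc₃
  have hpt : ∀ b w : Pt, |biBubbleTable (Ga n a) (Ga n a) SbT (projPiece n a) μ ν (b + w) b|
      ≤ (K * (A₁m * c₃ * (kM / (n : ℝ) ^ 3 + kM' / (n : ℝ) ^ 4))) * (Real.exp (-(δm / n) * supNorm (d := 4) w) / nrm (d := 4) w ^ 3)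
        + (K * (A₀ * c₂ * (kM' / (n : ℝ) ^ 4))) * (Real.exp (-(δm / n) * supNorm (d := 4) w) / nrm (d := 4) w ^ 2) := fun b w =>
    (abs_locProj_word_le n a ha hA hframe hA₀ hA₁m0 hδm0 (KC := kM / (n : ℝ) ^ 3) (KC₁ := kM' / (n : ℝ) ^ 4)
      (by positivity) (by positivity) hprofn hdRn hdLn hC0n hC1n hT0n hT1n μ ν b w).trans (le_of_eq (by rw [hc₂, hc₃]; ring))
  have hkM'le : kM' / (n : ℝ) ^ 4 ≤ kM' / (n : ℝ) ^ 3 :=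
    div_le_div_of_nonneg_left hkM'0 (by positivity) (pow_le_pow_right₀ (by exact_mod_cast NeZero.one_le) (by norm_num))
  have hsite : ∀ b : Pt, |fullSum (fun w : Pt => toReal w μ * toReal w ν *
      biBubbleTable (Ga n a) (Ga n a) SbT (projPiece n a) μ ν (b + w) b)| ≤ C := by
    intro b
    refine (abs_fullSum_le_of_envelope n hδm0 (by positivity) (by positivity) (hpt b) μ ν).trans ?_
    rw [hC]
    have e1 : K * (A₀ * c₂ * (kM' / (n : ℝ) ^ 4)) * ((1 + 1296 * ((2 / δm) ^ 3 * (1 + 2 / δm))) * (n : ℝ) ^ 4)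
        = K * (A₀ * (Real.exp (δm * R) * ((R : ℝ) + 1) ^ 2) * kM' * (1 + 1296 * ((2 / δm) ^ 3 * (1 + 2 / δm)))) := by
      rw [hc₂]; field_simp
    have e2 : K * (A₁m * c₃ * (kM / (n : ℝ) ^ 3 + kM' / (n : ℝ) ^ 4)) * ((1 + 432 * ((2 / δm) ^ 2 * (1 + 2 / δm))) * (n : ℝ) ^ 3)
        ≤ K * (A₁m * (Real.exp (δm * R) * ((R : ℝ) + 1) ^ 3) * (kM + kM') * (1 + 432 * ((2 / δm) ^ 2 * (1 + 2 / δm)))) := by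
      have h2 : kM / (n : ℝ) ^ 3 + kM' / (n : ℝ) ^ 4 ≤ (kM + kM') / (n : ℝ) ^ 3 := by rw [add_div]; exact add_le_add le_rfl hkM'le
      have h3 : K * (A₁m * c₃ * (kM / (n : ℝ) ^ 3 + kM' / (n : ℝ) ^ 4)) ≤ K * (A₁m * c₃ * ((kM + kM') / (n : ℝ) ^ 3)) :=
        mul_le_mul_of_nonneg_left (mul_le_mul_of_nonneg_left h2 (by positivity)) hK
      refine (mul_le_mul_of_nonneg_right h3 (by positivity)).trans (le_of_eq ?_)
      rw [hc₃]; field_simp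
    exact (add_le_add e2 (le_of_eq e1)).trans (le_of_eq (by ring))
  rw [cellSum_def]
  calc |∑ b ∈ (univ : Finset (Fin 4 → Fin n)).image resSite, ((n : ℝ) ^ 4)⁻¹ *
          fullSum (fun w : Pt => toReal w μ * toReal w ν * biBubbleTable (Ga n a) (Ga n a) SbT (projPiece n a) μ ν (b + w) b)|
      ≤ ∑ b ∈ (univ : Finset (Fin 4 → Fin n)).image resSite, ((n : ℝ) ^ 4)⁻¹ * C := by
        refine (Finset.abs_sum_le_sum_abs _ _).trans (Finset.sum_le_sum fun b _ => ?_)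
        rw [abs_mul, abs_of_nonneg (by positivity : (0 : ℝ) ≤ ((n : ℝ) ^ 4)⁻¹)]
        exact mul_le_mul_of_nonneg_left (hsite b) (by positivity)
    _ ≤ C := sum_resSite_avg_le (by positivity)

end

end Summit.QuantumFields.BalabanUV.Beta.D1BFx.GluonLocalProjRow
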